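import Literature.AlgebraicGeometry.HodgeTheory.HypersurfaceEigenHodgeNumbersJacobian
import Literature.AlgebraicGeometry.HodgeTheory.DiagonalSymmetryJacobianHilbertFunction
import Literature.AlgebraicGeometry.HodgeTheory.CompleteIntersectionHilbertFunction
import Literature.AlgebraicGeometry.HodgeTheory.CyclicCoverEigenHodgeNumbers
import Summits.HodgeConjecture.HodgeConjecture.Theorems.CyclicUnitaryPowersJacobianEigenparts
import HarnessLib

/-!
# K1 `VeryGeneralDeckCommutatorsInHg` (route `CyclicUnitaryPowers`, stmt-HodgeConjecture-19544): the Carlson–Toledo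
# eigen-Hodge numbers of the cyclic covers of the plane FROM Voisin's equivariant Jacobian-ring fact

The cited fact `carlsonToledo1999_finrank_eigenspace_inf_hodgePiece` (CT2; Carlson–Toledo 1999 §5: the
`ζ_p^i`-eigenspace of the deck transformation on `H^{2−q,q}(X_F)`, `X_F = V₊(x₃^p − f) ⊂ ℙ³`, has the dimension of
the degree-`(q+1)p − 3 − i` piece of the Jacobian ring `R_f` of the ternary branch form `f`) is, as its own
docstring says, "the instance for the cyclic covers of the plane" of the general equivariant Jacobian-ring fact
`voisin2003_finrank_eigenspace_inf_hodgePiece_of_diagonalStabilizer` (Voisin II Thm 6.10 / Cor. 6.12 read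
equivariantly for a diagonal symmetry) — the binder `hV` of route B's crux `VeryGeneralSignCommutatorsInHg`
(stmt-HodgeConjecture-19716).  This file PROVES that instance: `carlsonToledo1999_finrank_eigenspace_inf_hodgePiece_of_voisin :
voisin2003_… → carlsonToledo1999_finrank_eigenspace_inf_hodgePiece`, so that the two K1 cruxes of cell
`hodge-nonav` share ONE eigen-Hodge-number binder.

Proof.  For `F = x₃^p − f` (`cyclicCoverForm p f`) and the deck unit `a = (1,1,1,ζ_p)` (`deckUnit p`): `aᵢ^p = 1`,
`∏ aᵢ = ζ_p`, and `X_F` smooth with `f ≠ 0` forces a power of every variable into the Jacobian ideals `J_f` and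
`J_F = (∂₀f, ∂₁f, ∂₂f, p x₃^{p−1})` (`exists_X_pow_mem_jacobianIdeal_of_isSmoothProjective`, prover-A), hence `F` is a
nonsingular form.  Voisin's fact gives the eigen-Hodge number as the `ζ_p^i`-refined Hilbert function of `J_F` in degree
`m = (q+1)p − 4` (the hyperplane term vanishes as `ζ_p^i ≠ 1`); the tree's character-refined Macaulay theorem
`refinedHilbert_jacobianIdeal_eq_card` (file `DiagonalSymmetryJacobianHilbertFunction`) turns it into the box count
`#{β ∈ [0,p−2]⁴ : |β| = m, ζ_p^{β₃+1} = ζ_p^i}` `= #{β ∈ [0,p−2]⁴ : |β| = m, β₃ = i−1}`, and Macaulay's theorem for the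
ternary form (`hilbert_jacobianIdeal_eq_card`) turns `dim S₃^{m'} − dim J_f^{m'}`, `m' = (q+1)p − 3 − i = m − (i−1)`, into
`#{β' ∈ [0,p−2]³ : |β'| = m'}`; the two boxes are in bijection by `β ↦ β|_{x₀,x₁,x₂}`.
-/

noncomputable section

open MvPolynomial Module Finset
open Literature.RingTheory.MvPolynomial Literature.AlgebraicGeometry.Motives Literature.AlgebraicGeometry.HodgeTheory
open Literature.AlgebraicGeometry.Motives.UniversalHypersurface
open Summit.HodgeConjecture.HodgeConjecture.Theorems.CyclicUnitaryPowersJacobianEigenparts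
  (val_deckUnit_last val_deckUnit_castSucc diagonalCharacter_deckUnit pderiv_castSucc_cyclicCoverForm
    X_last_pow_mem_jacobianIdeal)

set_option linter.dupNamespace false

namespace Summit.HodgeConjecture.HodgeConjecture.Theorems.CyclicUnitaryPowersEigenHodgeOfVoisin

/-! ### §1 The deck unit: `∏ aᵢ = ζ`, `aᵢ^p = 1` (its values and character are in `CyclicUnitaryPowersJacobianEigenparts`) -/

/-- `∏ᵢ aᵢ = ζ_p` for the deck unit. [cite: CarlsonToledo1999, §5 (held text p0011)] -/
theorem prod_deckUnit_val (p : ℕ) :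
    ∏ i, ((deckUnit p i : ℂˣ) : ℂ) = Complex.exp (2 * (Real.pi : ℂ) * Complex.I / (p : ℂ)) := by
  rw [Fin.prod_univ_castSucc, val_deckUnit_last]
  simp [val_deckUnit_castSucc]

/-- `aᵢ^p = 1` for the deck unit (`ζ_p^p = 1`). [cite: CarlsonToledo1999, §5 (held text p0011)] -/
theorem deckUnit_pow_eq_one {p : ℕ} (hp : p ≠ 0) (i : Fin 4) : (deckUnit p i) ^ p = 1 := by
  apply Units.ext
  rw [Units.val_pow_eq_pow_val, Units.val_one]
  rcases Fin.eq_castSucc_or_eq_last i with ⟨j, rfl⟩ | rfl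
  · rw [val_deckUnit_castSucc, one_pow]
  · rw [val_deckUnit_last]
    exact (Complex.isPrimitiveRoot_exp p hp).pow_eq_one

/-! ### §2 The Jacobian ideal of `x₃^p − f` contains powers of all variables; nonsingularity -/

/-- **If a power of every variable lies in `J_f`, a power of every variable lies in `J_F`**, `F = x₃^p − f`, `p ≠ 0`:
`x_j^M = rename(x_j^M) ∈ rename(J_f) ⊆ J_F` (`rename ∂_j f = −∂_j F`) and `x₃^{p−1} = p⁻¹ ∂₃F ∈ J_F`.
[cite: VoisinHodgeII2003, §6.2.2 before Def. 6.18 (held text chunk p0165)] -/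
theorem exists_X_pow_mem_jacobianIdeal_cyclicCoverForm {p : ℕ} (hp : p ≠ 0) (f : MvPolynomial (Fin 3) ℂ) {M : ℕ}
    (hM : ∀ l, (X l : MvPolynomial (Fin 3) ℂ) ^ M ∈ jacobianIdeal f) :
    ∀ l, (X l : MvPolynomial (Fin 4) ℂ) ^ (M + (p - 1)) ∈ jacobianIdeal (cyclicCoverForm p f) := by
  have hmap : (jacobianIdeal f).map (rename Fin.castSucc : MvPolynomial (Fin 3) ℂ →ₐ[ℂ] MvPolynomial (Fin 4) ℂ).toRingHom ≤
      jacobianIdeal (cyclicCoverForm p f) := by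
    rw [show jacobianIdeal f = Ideal.span (Set.range fun j => pderiv j f) from rfl, Ideal.map_span, Ideal.span_le]
    rintro _ ⟨_, ⟨j, rfl⟩, rfl⟩
    have h : rename Fin.castSucc (pderiv j f) = -pderiv (Fin.castSucc j) (cyclicCoverForm p f) := by
      rw [pderiv_castSucc_cyclicCoverForm, neg_neg]
    change (rename Fin.castSucc) (pderiv j f) ∈ jacobianIdeal (cyclicCoverForm p f)
    rw [h]
    exact Submodule.neg_mem _ (pderiv_mem_jacobianIdeal _ _)
  have hlast : (X (Fin.last 3) : MvPolynomial (Fin 4) ℂ) ^ (p - 1) ∈ jacobianIdeal (cyclicCoverForm p f) :=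
    X_last_pow_mem_jacobianIdeal hp f
  intro l
  rcases Fin.eq_castSucc_or_eq_last l with ⟨j, rfl⟩ | rfl
  · rw [pow_add]
    refine Ideal.mul_mem_right _ _ (hmap ?_)
    have h := Ideal.mem_map_of_mem (rename Fin.castSucc : MvPolynomial (Fin 3) ℂ →ₐ[ℂ] MvPolynomial (Fin 4) ℂ).toRingHom (hM j)
    simpa only [AlgHom.toRingHom_eq_coe, RingHom.coe_coe, map_pow, rename_X] using h
  · rw [pow_add]
    exact Ideal.mul_mem_left _ _ hlast

/-- A form whose Jacobian ideal contains a power of every variable is nonsingular (a prime ideal containing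
the partials contains all variables). [cite: VoisinHodgeII2003, §6.2.2 before Def. 6.18 (held text chunk p0165)] -/
theorem isNonsingularForm_of_X_pow_mem_jacobianIdeal {n : ℕ} {F : MvPolynomial (Fin (n + 2)) ℂ} {M : ℕ}
    (hM : ∀ l, (X l : MvPolynomial (Fin (n + 2)) ℂ) ^ M ∈ jacobianIdeal F) :
    SmoothHypersurface.IsNonsingularForm ℂ F := by
  intro 𝔭 h𝔭 _ hd i
  have hJ : jacobianIdeal F ≤ 𝔭 := by
    rw [show jacobianIdeal F = Ideal.span (Set.range fun j => pderiv j F) from rfl, Ideal.span_le]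
    rintro _ ⟨j, rfl⟩
    exact hd j
  exact h𝔭.mem_of_pow_mem M (hJ (hM i))

/-! ### §3 Eigenspaces of the plain and twisted diagonal actions -/

/-- The `λ`-eigenspace of the plain substitution `P ↦ P(a • x)` is the `λ ∏ aᵢ`-eigenspace of the twisted action
`T_a = (∏ aᵢ) · (P ↦ P(a • x))`. [cite: Shioda1979HodgeFermat, §1 (1.7)] -/
theorem eigenspace_aeval_diagonalSubst_eq {n : ℕ} (a : Fin (n + 2) → ℂˣ) (μ : ℂ) :
    Module.End.eigenspace (MvPolynomial.aeval (diagonalSubst a)).toLinearMap (μ * (∏ i, ((a i : ℂˣ) : ℂ))⁻¹) =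
      Module.End.eigenspace (twistedDiagonalAction a) μ := by
  have hc : (∏ i, ((a i : ℂˣ) : ℂ)) ≠ 0 := prod_units_val_ne_zero a
  ext P
  rw [Module.End.mem_eigenspace_iff, Module.End.mem_eigenspace_iff, twistedDiagonalAction_apply]
  constructor
  · intro h
    rw [AlgHom.toLinearMap_apply] at h
    rw [h, smul_smul, mul_comm, mul_assoc, inv_mul_cancel₀ hc, mul_one]
  · intro h
    rw [AlgHom.toLinearMap_apply]
    have h2 := congrArg (fun Q => (∏ i, ((a i : ℂˣ) : ℂ))⁻¹ • Q) h
    simp only [smul_smul, inv_mul_cancel₀ hc, one_smul] at h2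
    rw [h2, mul_comm]

/-! ### §4 The box-count bijection `β ↦ β|_{x₀,x₁,x₂}` -/

/-- **The boxes match**: exponents `β ∈ [0,p−2]⁴` of total degree `m' + e` with `β₃ = e` correspond to exponents
`β' ∈ [0,p−2]³` of total degree `m'` (restriction to the first three variables), for `e ≤ p − 2`. [folklore] -/
theorem card_box_last_eq (p m' e : ℕ) (he : e ≤ p - 2) :
    (((univ : Finset (Fin 4)).finsuppAntidiag (m' + e)).filter
        fun β : Fin 4 →₀ ℕ => (∀ i, β i ≤ p - 2) ∧ β (Fin.last 3) = e).card =
      (((univ : Finset (Fin 3)).finsuppAntidiag m').filter fun β' : Fin 3 →₀ ℕ => ∀ j, β' j ≤ p - 2).card := by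
  refine Finset.card_bij' (fun β _ => Finsupp.equivFunOnFinite.symm fun j => β (Fin.castSucc j))
    (fun β' _ => Finsupp.equivFunOnFinite.symm (Fin.snoc (fun j => β' j) e)) ?_ ?_ ?_ ?_
  · intro β hβ
    simp only [mem_filter, mem_finsuppAntidiag] at hβ ⊢
    obtain ⟨⟨hsum, -⟩, hle, hlast⟩ := hβ
    refine ⟨⟨?_, fun _ _ => mem_univ _⟩, fun j => ?_⟩
    · have h := Fin.sum_univ_castSucc (fun i => β i)
      rw [hsum, hlast] at h
      simp only [Finsupp.coe_equivFunOnFinite_symm]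
      omega
    · simp only [Finsupp.coe_equivFunOnFinite_symm]; exact hle _
  · intro β' hβ'
    simp only [mem_filter, mem_finsuppAntidiag] at hβ' ⊢
    obtain ⟨⟨hsum, -⟩, hle⟩ := hβ'
    refine ⟨⟨?_, fun _ _ => mem_univ _⟩, fun i => ?_, ?_⟩
    · rw [Fin.sum_univ_castSucc]
      simp only [Finsupp.coe_equivFunOnFinite_symm, Fin.snoc_castSucc, Fin.snoc_last]
      rw [hsum]
    · simp only [Finsupp.coe_equivFunOnFinite_symm]
      rcases Fin.eq_castSucc_or_eq_last i with ⟨j, rfl⟩ | rfl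
      · rw [Fin.snoc_castSucc]; exact hle j
      · rw [Fin.snoc_last]; exact he
    · simp only [Finsupp.coe_equivFunOnFinite_symm, Fin.snoc_last]
  · intro β hβ
    simp only [mem_filter, mem_finsuppAntidiag] at hβ
    obtain ⟨-, -, hlast⟩ := hβ
    ext i
    simp only [Finsupp.coe_equivFunOnFinite_symm]
    rcases Fin.eq_castSucc_or_eq_last i with ⟨j, rfl⟩ | rfl
    · rw [Fin.snoc_castSucc]
    · rw [Fin.snoc_last, hlast]
  · intro β' _
    ext j
    simp only [Finsupp.coe_equivFunOnFinite_symm, Fin.snoc_castSucc]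

/-! ### §5 CT2 from Voisin's fact -/

/-- **Carlson–Toledo's eigen-Hodge numbers of the cyclic covers of the plane FROM Voisin's equivariant Jacobian-ring
fact** (`carlsonToledo1999_finrank_eigenspace_inf_hodgePiece` is the instance `n = 2`, `F = x₃^p − f`, `a = (1,1,1,ζ_p)`,
`μ = ζ_p^i` of `voisin2003_finrank_eigenspace_inf_hodgePiece_of_diagonalStabilizer`, through the character-refined Macaulay
theorem for `J_F` and Macaulay's theorem for `J_f`). [cite: CarlsonToledo1999, §5 (held text p0011–p0012)]
[cite: VoisinHodgeII2003, §6.1.3 Thm. 6.10 and Cor. 6.12 (held text chunks p0159, p0161)]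
[cite: CarlsonMullerStachPeters2017, Thm. 7.4.1 (proof)] -/
theorem carlsonToledo1999_finrank_eigenspace_inf_hodgePiece_of_voisin
    (hV : voisin2003_finrank_eigenspace_inf_hodgePiece_of_diagonalStabilizer) :
    carlsonToledo1999_finrank_eigenspace_inf_hodgePiece := by
  intro hHD p hp3 f hf hf0 hX ha i q hi hip hq
  set ζ : ℂ := Complex.exp (2 * (Real.pi : ℂ) * Complex.I / (p : ℂ)) with hζdef
  have hp0 : p ≠ 0 := by omega
  have hζ : IsPrimitiveRoot ζ p := Complex.isPrimitiveRoot_exp p hp0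
  have hF : (cyclicCoverForm p f).IsHomogeneous p :=
    Summit.HodgeConjecture.HodgeConjecture.Theorems.CyclicUnitaryPowersCyclicCoverIrreducible.isHomogeneous_cyclicCoverForm hf
  -- powers of the variables in `J_f` and `J_F`; nonsingularity of `F`
  obtain ⟨M, -, hM⟩ :=
    Summit.HodgeConjecture.HodgeConjecture.Theorems.CyclicUnitaryPowersCyclicCoverIrreducible.exists_X_pow_mem_jacobianIdeal_of_isSmoothProjective
      (by omega) hf hf0 hX
  have hMF := exists_X_pow_mem_jacobianIdeal_cyclicCoverForm hp0 f hM
  have hNS : SmoothHypersurface.IsNonsingularForm ℂ (cyclicCoverForm p f) := isNonsingularForm_of_X_pow_mem_jacobianIdeal hMF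
  -- Voisin's fact at `n = 2`, `μ = ζ^i`
  have hVi := hV hHD 2 p (by norm_num) (cyclicCoverForm p f) hF hNS hX (deckUnit p) ha (ζ ^ i) q hq
  simp only [Nat.cast_ofNat] at hVi
  rw [hVi]
  -- the hyperplane term vanishes: `ζ^i ≠ 1`
  have hζi : ζ ^ i ≠ 1 := hζ.pow_ne_one_of_pos_of_lt (by omega) hip
  rw [if_neg (show ¬(ζ ^ i = 1 ∧ 2 * q = 2) from fun h => hζi h.1), add_zero]
  by_cases hsmall : (q + 1) * p < 2 + 2
  · -- only `p = 3`, `q = 0`: both sides vanish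
    have : (q + 1) * p < 3 + i := by omega
    rw [if_pos hsmall, if_pos this]
  rw [if_neg hsmall]
  -- the twisted eigenspace and the character-refined Macaulay theorem for `J_F`
  rw [eigenspace_aeval_diagonalSubst_eq (deckUnit p) (ζ ^ i)]
  · rw [refinedHilbert_jacobianIdeal_eq_card (n := 2) (by omega) hF ha (deckUnit_pow_eq_one hp0) hMF
      ((q + 1) * p - (2 + 2)) (ζ ^ i)]
    -- the character condition `ζ^{β₃+1} = ζ^i` is `β₃ = i − 1` on the box
    have hchar : ∀ β : Fin 4 →₀ ℕ, (∀ j, β j ≤ p - 2) →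
        (diagonalCharacter (deckUnit p) β = ζ ^ i ↔ β (Fin.last 3) = i - 1) := by
      intro β hβ
      rw [diagonalCharacter_deckUnit]
      constructor
      · intro h
        have h' := hζ.pow_inj (by have := hβ (Fin.last 3); omega) hip h
        omega
      · intro h
        rw [h, Nat.sub_add_cancel hi]
    have hfilt : (((univ : Finset (Fin 4)).finsuppAntidiag ((q + 1) * p - (2 + 2))).filter
          fun β : Fin 4 →₀ ℕ => (∀ j, β j ≤ p - 2) ∧ diagonalCharacter (deckUnit p) β = ζ ^ i) =
        ((univ : Finset (Fin 4)).finsuppAntidiag ((q + 1) * p - (2 + 2))).filter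
          fun β : Fin 4 →₀ ℕ => (∀ j, β j ≤ p - 2) ∧ β (Fin.last 3) = i - 1 := by
      refine Finset.filter_congr fun β _ => ?_
      constructor
      · rintro ⟨hle, hc⟩; exact ⟨hle, (hchar β hle).1 hc⟩
      · rintro ⟨hle, hc⟩; exact ⟨hle, (hchar β hle).2 hc⟩
    rw [hfilt]
    by_cases hlt : (q + 1) * p < 3 + i
    · -- empty box: `β₃ = i − 1 > m`
      rw [if_pos hlt, Finset.card_eq_zero, Finset.filter_eq_empty_iff]
      rintro β hβ ⟨-, hlast⟩
      rw [mem_finsuppAntidiag] at hβ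
      have h := Fin.sum_univ_castSucc (fun j => β j)
      rw [hβ.1, hlast] at h
      omega
    · rw [if_neg hlt]
      -- Macaulay for the ternary form `f`
      rw [hilbert_jacobianIdeal_eq_card (N := 2) hf (by omega) hM ((q + 1) * p - 3 - i)]
      have hm : (q + 1) * p - (2 + 2) = ((q + 1) * p - 3 - i) + (i - 1) := by omega
      rw [hm]
      exact card_box_last_eq p _ _ (by omega)

end Summit.HodgeConjecture.HodgeConjecture.Theorems.CyclicUnitaryPowersEigenHodgeOfVoisin

end
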